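import Summits.KontsevichZagierPeriods.Zeta5Search.DualSeriesLemma19
import Summits.KontsevichZagierPeriods.Zeta5Search.SymRayBasics
import HarnessLib

/-!
# ζ(5) search — Zudilin's Lemma 19 denominators for `F̃₇(b)`, II: the coefficients `U`, `W`, `V` (cell `pub-zeta5`, P1)

HONEST FRAMING: systematic search; no irrationality claim unless certified.

OUR instantiation (Summit side, P1 seat generation 4) of [Zudilin2004, §8 Lemma 19, (8.10)–(8.12)]
(W. Zudilin, *Arithmetic of linear forms involving odd zeta values*, J. Théor. Nombres Bordeaux 16 (2004)) on the
canonical coefficients of Brown–Zudilin's `F̃₇(b)`, from the window expansion `DualSeriesLemma19.exists_window_data`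
(normaliser `Ñ(b) = ∏_{j=2}^{7}(b₀ − 2b_j)!`, window `σ ≤ p ≤ b₀ − σ`, polynomial slot `1`):

* `coeffU_den19` — `d · Ñ(b) · U(b) ∈ ℤ`, `coeffW_den19` — `d³ · Ñ(b) · W(b) ∈ ℤ` for every common multiple `d` of
  `1,…,b₀ − 2σ` ((8.10): `D_{m₀}^{q−j} B_{jk} ∈ ℤ`, `m₀ = h₀ − 2h₂` at `σ = b₍₂₎`; the tree's `DualSeriesDenominators`
  has `d_{b₀}`, `d_{b₀}³` with Brown–Zudilin's normaliser `N(b)`);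
* `coeffV_shift` — the harmonic index shift of (8.6)/(8.12): `Ñ·V(b) = Σ_{o,p} Ñ c_{o,p}·H_{p−b₁}^{(o+1)}`
  (`R_b` vanishes at `t = −1,…,−b₁`, where the window expansion has no pole);
* `coeffV_den19` — `d⁶ · Ñ(b) · V(b) ∈ ℤ` for every common multiple `d` of `1,…,b₀ − σ − b₁` (`= m₁ = h₀ − h₁ − h₂`
  at `σ = b₍₂₎`; the tree had `d_{b₀}⁶`).
What is NOT here: the order-dependent windows of Lemma 19 (`D_{m₁}D_{m₂}⋯D_{m₆}` instead of `D_{m₁}⁶` on the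
constant term) and the prime-by-prime factor `Φ` ((8.8)–(8.9)).  Hypotheses throughout: `InBox b`,
`Σ_j b_j ≤ 3b₀ + 1`, `b₁ ≤ σ ≤ b_j` and `2b_j ≤ b₀` for `j = 2,…,7` (slot symmetry of `U, W, V` moves the polynomial
slot; see `WedgeDictionaryFaceSymmetric`).
-/

noncomputable section

open Finset Polynomial
open Literature.NumberTheory.Transcendental
open Literature.NumberTheory.Transcendental.BallRivoal

namespace Summit.KontsevichZagierPeriods.Zeta5Search

namespace DualSeriesLemma19

open DualSeries WedgeDictionary PFSteps DualSeriesDenominators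

/-! ### Denominators of `U(b)` and `W(b)` (Zudilin 2004, (8.10) summed over the poles) -/

/-- **`d · Ñ(b) · U(b) ∈ ℤ`** for every common multiple `d` of `1,…,b₀ − 2σ` [Zudilin2004, §8 Lemma 19, (8.10) with
`j = q − 1`: `D_{m₀}·B_{6k} ∈ ℤ`], on the box with `Σ_j b_j ≤ 3b₀+1`, `b₁ ≤ σ ≤ b_j`, `2b_j ≤ b₀` (`j ≥ 2`). -/
theorem coeffU_den19 {b : ℕ → ℤ} (hb : InBox b) (hsum : ∑ j ∈ range 7, b (j + 1) ≤ 3 * b 0 + 1)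
    {σ : ℕ} (hσ : ∀ s, s < 6 → σ ≤ bn b (s + 2)) (h2 : ∀ s, s < 6 → 2 * bn b (s + 2) ≤ bn b 0)
    (h1 : bn b 1 ≤ σ) (d : ℕ) (hdiv : ∀ k : ℕ, 1 ≤ k → k ≤ wtop b σ → (k : ℤ) ∣ d) :
    ∃ z : ℤ, (d : ℚ) * (normaliser19 b : ℚ) * coeffU b = z := by
  obtain ⟨c, hc, hint, -, -⟩ := exists_window_data hb hsum hσ h2 h1 d hdiv
  have hterm : ∀ p ∈ range (bn b 0 + 1), ∃ z : ℤ, (d : ℚ) * (normaliser19 b : ℚ) * c 4 p = z := by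
    intro p hp
    obtain ⟨z, hz⟩ := hint 4 p (by norm_num) (Nat.lt_succ_iff.1 (mem_range.1 hp))
    refine ⟨z, ?_⟩
    rw [← hz, show (5 : ℕ) - 4 = 1 by rfl, pow_one]
    ring
  choose z hz using hterm
  refine ⟨∑ p ∈ (range (bn b 0 + 1)).attach, z p.1 p.2, ?_⟩
  rw [coeffU_eq hc, show (b 0).toNat = bn b 0 by rfl, mul_sum, ← sum_attach]
  push_cast
  exact sum_congr rfl fun p _ => hz p.1 p.2

/-- **`d³ · Ñ(b) · W(b) ∈ ℤ`** for every common multiple `d` of `1,…,b₀ − 2σ` [Zudilin2004, §8 Lemma 19, (8.10) with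
`j = q − 3`: `D_{m₀}³·B_{4k} ∈ ℤ`]. -/
theorem coeffW_den19 {b : ℕ → ℤ} (hb : InBox b) (hsum : ∑ j ∈ range 7, b (j + 1) ≤ 3 * b 0 + 1)
    {σ : ℕ} (hσ : ∀ s, s < 6 → σ ≤ bn b (s + 2)) (h2 : ∀ s, s < 6 → 2 * bn b (s + 2) ≤ bn b 0)
    (h1 : bn b 1 ≤ σ) (d : ℕ) (hdiv : ∀ k : ℕ, 1 ≤ k → k ≤ wtop b σ → (k : ℤ) ∣ d) :
    ∃ z : ℤ, (d : ℚ) ^ 3 * (normaliser19 b : ℚ) * coeffW b = z := by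
  obtain ⟨c, hc, hint, -, -⟩ := exists_window_data hb hsum hσ h2 h1 d hdiv
  have hterm : ∀ p ∈ range (bn b 0 + 1), ∃ z : ℤ, (d : ℚ) ^ 3 * (normaliser19 b : ℚ) * c 2 p = z := by
    intro p hp
    obtain ⟨z, hz⟩ := hint 2 p (by norm_num) (Nat.lt_succ_iff.1 (mem_range.1 hp))
    refine ⟨z, ?_⟩
    rw [← hz, show (5 : ℕ) - 2 = 3 by rfl]
    ring
  choose z hz using hterm
  refine ⟨∑ p ∈ (range (bn b 0 + 1)).attach, z p.1 p.2, ?_⟩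
  rw [coeffW_eq hc, show (b 0).toNat = bn b 0 by rfl, mul_sum, ← sum_attach]
  push_cast
  exact sum_congr rfl fun p _ => hz p.1 p.2

/-! ### The constant term: Zudilin's shorter harmonic sums (8.12) -/

/-- Splitting a truncated zeta sum: `H_p^{(s)} = H_{p−β}^{(s)} + Σ_{i<β} (p − i)^{−s}` (`β ≤ p`). -/
theorem harm_split (s p β : ℕ) (h : β ≤ p) :
    harm s p = harm s (p - β) + ∑ i ∈ range β, 1 / ((p : ℚ) - i) ^ s := by
  obtain ⟨q, rfl⟩ : ∃ q, p = q + β := ⟨p - β, by omega⟩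
  rw [Nat.add_sub_cancel]
  induction β with
  | zero => simp
  | succ β ih =>
    rw [show q + (β + 1) = (q + β) + 1 by ring, SymRay.harm_succ, ih (by omega), sum_range_succ']
    push_cast
    have e : ∀ i ∈ range β, (1 : ℚ) / ((q : ℚ) + β + 1 - ((i : ℚ) + 1)) ^ s = 1 / ((q : ℚ) + β - i) ^ s := by
      intro i _
      rw [show (q : ℚ) + β + 1 - ((i : ℚ) + 1) = (q : ℚ) + β - i by ring]
    rw [sum_congr rfl e, sub_zero]
    ring

/-- **The harmonic index shift** (mechanism of (8.6)/(8.12) in Zudilin 2004): for data `c` of `R_b` vanishing off the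
window `σ ≤ p` and with `Σ_{o,p} Ñ c_{o,p}/(p−i)^{o+1} = 0` for `i < b₁`,
`Ñ · V(b) = Σ_{o<6} Σ_{p≤b₀} Ñ c_{o,p} · H_{p − b₁}^{(o+1)}`. -/
theorem coeffV_shift_of {b : ℕ → ℤ} {c : ℕ → ℕ → ℚ} (hc : IsPFData b c) {σ : ℕ} (h1 : bn b 1 ≤ σ) (N : ℚ)
    (hsupp : ∀ o p, o < 6 → p ≤ bn b 0 → p < σ → c o p = 0)
    (hvan : ∀ i : ℕ, i < bn b 1 → pfEval (bn b 0) 6 (fun o p => N * c o p) (-((i : ℚ) + 1)) = 0) :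
    N * coeffV b = ∑ o ∈ range 6, ∑ p ∈ range (bn b 0 + 1), N * c o p * harm (o + 1) (p - bn b 1) := by
  have hV : coeffV b = ∑ o ∈ range 6, ∑ p ∈ range (bn b 0 + 1), c o p * harm (o + 1) p := by
    rw [coeffV_eq hc]; rfl
  rw [hV, mul_sum]
  simp_rw [mul_sum]
  -- termwise split of the harmonic sums
  have hsplit : ∀ o ∈ range 6, ∀ p ∈ range (bn b 0 + 1),
      N * (c o p * harm (o + 1) p) = N * c o p * harm (o + 1) (p - bn b 1) +
        ∑ i ∈ range (bn b 1), N * c o p / (-((i : ℚ) + 1) + p + 1) ^ (o + 1) := by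
    intro o ho p hp
    by_cases hpσ : p < σ
    · rw [hsupp o p (mem_range.1 ho) (Nat.lt_succ_iff.1 (mem_range.1 hp)) hpσ]
      simp
    · rw [harm_split (o + 1) p (bn b 1) (by omega)]
      simp only [mul_add, mul_sum]
      congr 1
      · ring
      · refine sum_congr rfl fun i _ => ?_
        rw [show (-((i : ℚ) + 1) + p + 1) = (p : ℚ) - i by ring]
        ring
  rw [sum_congr rfl fun o ho => sum_congr rfl fun p hp => hsplit o ho p hp]
  simp only [sum_add_distrib]
  -- the correction is `Σ_i pfEval (Ñ c) (−(i+1)) = 0`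
  have hcorr : ∑ o ∈ range 6, ∑ p ∈ range (bn b 0 + 1), ∑ i ∈ range (bn b 1),
      N * c o p / (-((i : ℚ) + 1) + p + 1) ^ (o + 1) = 0 := by
    rw [sum_comm]
    simp_rw [sum_comm (s := range 6) (t := range (bn b 1))]
    rw [sum_comm]
    refine sum_eq_zero fun i hi => ?_
    have h := hvan i (mem_range.1 hi)
    unfold pfEval at h
    exact h
  rw [hcorr, add_zero]

/-- **The harmonic index shift for the canonical data** [Zudilin2004, §8, (8.6) and (8.12)]:
`Ñ(b) · V(b) = Σ_{o,p} Ñ(b) c_{o,p} H_{p−b₁}^{(o+1)}` with `c = pfData b`. -/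
theorem coeffV_shift {b : ℕ → ℤ} (hb : InBox b) (hsum : ∑ j ∈ range 7, b (j + 1) ≤ 3 * b 0 + 1)
    {σ : ℕ} (hσ : ∀ s, s < 6 → σ ≤ bn b (s + 2)) (h2 : ∀ s, s < 6 → 2 * bn b (s + 2) ≤ bn b 0)
    (h1 : bn b 1 ≤ σ) :
    (normaliser19 b : ℚ) * coeffV b =
      ∑ o ∈ range 6, ∑ p ∈ range (bn b 0 + 1), (normaliser19 b : ℚ) * pfData b o p * harm (o + 1) (p - bn b 1) := by
  obtain ⟨c, hc, -, hsupp, hvan⟩ := exists_window_data hb hsum hσ h2 h1 0 (fun k _ _ => dvd_zero _)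
  have hpf : ∀ o p, o < 6 → p ≤ bn b 0 → pfData b o p = c o p := fun o p ho hp =>
    (isPFData_pfData hc).eq hc ho hp
  rw [coeffV_shift_of hc h1 _ (fun o p ho hp hpσ => hsupp o p ho hp (fun h => by omega)) hvan]
  exact sum_congr rfl fun o ho => sum_congr rfl fun p hp => by
    rw [hpf o p (mem_range.1 ho) (Nat.lt_succ_iff.1 (mem_range.1 hp))]

/-- **`d⁶ · Ñ(b) · V(b) ∈ ℤ`** for every common multiple `d` of `1,…,b₀ − σ − b₁` (Zudilin's `m₁` at `σ = b₍₂₎`)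
[Zudilin2004, §8 Lemma 19, (8.10)–(8.12): the constant term `A₀` with the harmonic sums `H_{k−h₁}`; here with the
single window `σ ≤ p ≤ b₀ − σ`, i.e. `D_{m₁}⁶` in place of the printed `D_{m₁}D_{m₂}⋯D_{m₆}`]. -/
theorem coeffV_den19 {b : ℕ → ℤ} (hb : InBox b) (hsum : ∑ j ∈ range 7, b (j + 1) ≤ 3 * b 0 + 1)
    {σ : ℕ} (hσ : ∀ s, s < 6 → σ ≤ bn b (s + 2)) (h2 : ∀ s, s < 6 → 2 * bn b (s + 2) ≤ bn b 0)
    (h1 : bn b 1 ≤ σ) (d : ℕ) (hdiv : ∀ k : ℕ, 1 ≤ k → k ≤ bn b 0 - σ - bn b 1 → (k : ℤ) ∣ d) :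
    ∃ z : ℤ, (d : ℚ) ^ 6 * (normaliser19 b : ℚ) * coeffV b = z := by
  have hdiv' : ∀ k : ℕ, 1 ≤ k → k ≤ wtop b σ → (k : ℤ) ∣ d := fun k hk1 hk2 =>
    hdiv k hk1 (by unfold wtop at hk2; omega)
  obtain ⟨c, hc, hint, hsupp, hvan⟩ := exists_window_data hb hsum hσ h2 h1 d hdiv'
  have h2σ : 2 * σ ≤ bn b 0 := by have := hσ 0 (by norm_num); have := h2 0 (by norm_num); omega
  have hterm : ∀ o ∈ range 6, ∀ p ∈ range (bn b 0 + 1), ∃ z : ℤ,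
      (d : ℚ) ^ 6 * ((normaliser19 b : ℚ) * c o p * harm (o + 1) (p - bn b 1)) = z := by
    intro o ho p hp
    have ho' := mem_range.1 ho
    have hp' := Nat.lt_succ_iff.1 (mem_range.1 hp)
    by_cases hw : σ ≤ p ∧ p ≤ σ + wtop b σ
    · obtain ⟨z, hz⟩ := hint o p ho' hp'
      obtain ⟨w, hw'⟩ := isInt_dpow_mul_harm (bn b 0 - σ - bn b 1) d hdiv (o + 1) (p - bn b 1)
        (by unfold wtop at hw; omega)
      refine ⟨z * w, ?_⟩
      have e : (6 : ℕ) = (5 - o) + (o + 1) := by omega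
      rw [e, pow_add]
      push_cast
      rw [← hz, ← hw']
      ring
    · rw [hsupp o p ho' hp' hw]
      exact ⟨0, by simp⟩
  choose z hz using hterm
  refine ⟨∑ o ∈ (range 6).attach, ∑ p ∈ (range (bn b 0 + 1)).attach, z o.1 o.2 p.1 p.2, ?_⟩
  rw [mul_assoc, coeffV_shift_of hc h1 _ (fun o p ho hp hpσ => hsupp o p ho hp (fun h => by omega)) hvan,
    mul_sum, ← sum_attach]
  push_cast
  refine sum_congr rfl fun o _ => ?_
  rw [mul_sum, ← sum_attach]
  exact sum_congr rfl fun p _ => hz o.1 o.2 p.1 p.2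

end DualSeriesLemma19

end Summit.KontsevichZagierPeriods.Zeta5Search
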